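import Literature.AlgebraicGeometry.HodgeTheory.BettiUniverseAxioms
import Literature.AlgebraicGeometry.HodgeTheory.BettiUniverseCMAction
import Literature.AlgebraicGeometry.HodgeTheory.AbelianVarietyMultiplicationPullback
import Literature.AlgebraicGeometry.Motives.AbelianVarietyProductIsogeny
import Literature.NumberTheory.DiophantineGeometry.AVIsogenySymmProofs
import Literature.AlgebraicGeometry.ComplexMultiplication.ShimuraInflationBettiJunctions
import HarnessLib

/-!
# The domination calculus for complex abelian varieties (`IsDominatedBy`, `AVDominatedBy`)

Stage 1's model fact M14 `HodgeCM.Universe.Fact_cmDominated` (package `HodgeCMPerL`,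
`HodgeCM/Geometry/Facts.lean` l.101) asks, for every CM abelian variety `X` of the universe, for a
Galois CM field `F` of degree `≥ 6`, CM types `Θ_j` of `F`, morphisms `s : X → ∏_j A_{(F,Θ_j)}`,
`π : ∏_j A_{(F,Θ_j)} → X` and `N ≠ 0` with `(π ∘ s)^* = N^k` on `H^k(X, ℚ)` for all `k`. This file
isolates the target-independent half of that statement as two predicates and proves their calculus —
everything here is KERNEL (no named fact is used):

* `IsDominatedBy X P` (scheme level, the literal shape of M14's conclusion for fixed `P`): there are
  `s : X ⟶ P`, `π : P ⟶ X`, `N ≠ 0` with `(s ≫ π)^* = N^k • id` on `Hᵏ(X(ℂ); ℚ)` for every `k`;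
* `AVDominatedBy A P` (abelian-variety level): there are homomorphisms `s : A ⟶ P`, `π : P ⟶ A` and
  `N ≠ 0` with `s ≫ π = [N]_A`.

Calculus: `[N]_A^* = N^k` on rational `Hᵏ` (from the tree's complex statement
`complexBetti_map_nsmul_id_apply`, Mumford §1 (3), by the injective natural lattice map
`Hᵏ(–; ℚ) → Hᵏ(–; ℂ)`), hence `AVDominatedBy A P → IsDominatedBy A.X P.X`; reflexivity, transitivity;
transport along isomorphisms (both levels) and along ISOGENIES in either direction (quasi-inverses:
the tree's `IsIsogeny.exists_nsmul_inverse_holds`, Mumford §19 Remark p. 169); binary products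
(`AbelianVariety.prodMap`). The M14 instances for the two model universes (`Model.universeOf`, codes;
`Model2.universe₂`, iso-complete) are then: leaves (Shimura inflation of a realised CM code to one Galois
CM field — the binders `Shimura1998_Thm3_isogenousPower`, `Shimura1998_Thm2_Cor`), products, and — for
the iso-complete universe only — one isogeny step (CM domination by realised codes, tree
`Milne1999.hDom_of_hSimple`). Those instances live in the companion file; nothing here mentions codes.

References: D. Mumford, *Abelian Varieties* (1970), §1 (3), §19 (Remark p. 169, Thm. 1).

Provenance: Literature home (namespace `Literature.AlgebraicGeometry.ComplexMultiplication.Domination`) of the Summits-side `HodgeConjecture/HodgeConjecture/Theorems/CorCMDomination` (imports `Literature/` and Mathlib only), re-homed so that the Literature named facts it proves are discharged Literature-side under their exact names. Lane `lit-hodgefound`, seat p20.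
-/

noncomputable section

open _root_.CategoryTheory
open Literature.AlgebraicGeometry.Motives Literature.AlgebraicGeometry.HodgeTheory
open Literature.AlgebraicTopology.SingularHomology (singularCohomology)

namespace Literature.AlgebraicGeometry.ComplexMultiplication.Domination

/-! ### The two predicates -/

/-- **`X` is dominated by `P` up to a nonzero integer** (scheme level; the conclusion shape of stage-1
M14 `Fact_cmDominated` for a fixed target `P`): morphisms `s : X ⟶ P`, `π : P ⟶ X` over `ℂ` and
`N ≠ 0` with `(s ≫ π)^* = N^k • id` on `Hᵏ(X(ℂ); ℚ)` for every `k`. [cite: MumfordAV1970, §19 (remark before Thm. 1, p. 169), auxiliary definition] -/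
def IsDominatedBy (X P : SchemeOver ℂ) : Prop :=
  ∃ (s : X ⟶ P) (π : P ⟶ X) (N : ℕ), N ≠ 0 ∧
    ∀ k : ℕ, BettiUniverse.pull (s ≫ π) k = ((N : ℚ) ^ k) • LinearMap.id

/-- **`A` is dominated by `P` as an abelian variety**: homomorphisms `s : A ⟶ P`, `π : P ⟶ A` and
`N ≠ 0` with `s ≫ π = [N]_A` (Mumford §19: `A` is then an isogeny factor of `P`). [cite: MumfordAV1970, §19 (remark before Thm. 1, p. 169), auxiliary definition] -/
def AVDominatedBy (A P : AbelianVariety ℂ) : Prop :=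
  ∃ (s : A ⟶ P) (π : P ⟶ A) (N : ℕ), N ≠ 0 ∧ s ≫ π = N • 𝟙 A

/-! ### `[N]^* = N^k` on rational cohomology -/

/-- **`[N]_A^* = N^k • id` on `Hᵏ(A(ℂ); ℚ)`** — the rational form of the tree's
`complexBetti_map_nsmul_id_apply` (Mumford §1 (3): `H^k(A) = ⋀^k H¹(A)` and `[N]^* = N` on `H¹`),
descended along the injective natural lattice map `Hᵏ(A(ℂ); ℚ) → Hᵏ(A(ℂ); ℂ)`.
[cite: MumfordAV1970, §1 (3) and §19] -/
theorem pull_nsmul_id (A : AbelianVariety ℂ) (N k : ℕ) :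
    BettiUniverse.pull (N • 𝟙 A : A ⟶ A).hom.hom.hom k = ((N : ℚ) ^ k) • LinearMap.id := by
  refine LinearMap.ext fun v ↦ ofRatClass_injective k ?_
  change ofRatClass (ComplexPoints A.X) k (bettiCohomology.map (N • 𝟙 A : A ⟶ A).hom.hom.hom k v) =
    ofRatClass (ComplexPoints A.X) k (((N : ℚ) ^ k) • v)
  rw [ofRatClass_map k _ v, ofRatClass_smul]
  change complexBetti.map (N • 𝟙 A : A ⟶ A).hom.hom.hom k (ofRatClass (ComplexPoints A.X) k v) = _
  rw [complexBetti_map_nsmul_id_apply A N k]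
  push_cast
  rfl

/-! ### Abelian-variety level ⇒ scheme level -/

/-- Composition of homomorphisms of abelian varieties is composition of the underlying `ℂ`-morphisms.
 [cite: MumfordAV1970, §19 (remark before Thm. 1, p. 169), auxiliary step] -/
theorem hom_comp_eq {A B C : AbelianVariety ℂ} (f : A ⟶ B) (g : B ⟶ C) :
    (f ≫ g).hom.hom.hom = f.hom.hom.hom ≫ g.hom.hom.hom := rfl

/-- **AV-domination implies domination of the underlying varieties.** [cite: MumfordAV1970, §19] -/
theorem AVDominatedBy.isDominatedBy {A P : AbelianVariety ℂ} (h : AVDominatedBy A P) :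
    IsDominatedBy A.X P.X := by
  obtain ⟨s, π, N, hN, hsπ⟩ := h
  refine ⟨s.hom.hom.hom, π.hom.hom.hom, N, hN, fun k ↦ ?_⟩
  rw [← hom_comp_eq, hsπ]
  exact pull_nsmul_id A N k

/-! ### Calculus at the abelian-variety level -/

namespace AVDominatedBy

variable {A B P Q A' P' : AbelianVariety ℂ}

/-- Reflexivity: `A` is `1`-dominated by itself. [cite: MumfordAV1970, §19 (remark before Thm. 1, p. 169), auxiliary step] -/
theorem refl (A : AbelianVariety ℂ) : AVDominatedBy A A :=
  ⟨𝟙 A, 𝟙 A, 1, one_ne_zero, by simp⟩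

/-- Transitivity: `N`- and `M`-domination compose to `NM`-domination. [cite: MumfordAV1970, §19 (remark before Thm. 1, p. 169), auxiliary step] -/
theorem trans (h₁ : AVDominatedBy A P) (h₂ : AVDominatedBy P Q) : AVDominatedBy A Q := by
  obtain ⟨s₁, π₁, N, hN, h₁⟩ := h₁
  obtain ⟨s₂, π₂, M, hM, h₂⟩ := h₂
  refine ⟨s₁ ≫ s₂, π₂ ≫ π₁, M * N, mul_ne_zero hM hN, ?_⟩
  rw [Category.assoc, ← Category.assoc s₂, h₂, Preadditive.nsmul_comp, Category.id_comp,
    Preadditive.comp_nsmul, h₁, mul_smul]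

/-- Transport along an isomorphism of the dominated variety. [cite: MumfordAV1970, §19 (remark before Thm. 1, p. 169), auxiliary step] -/
theorem of_iso (e : A ≅ B) (h : AVDominatedBy B P) : AVDominatedBy A P := by
  obtain ⟨s, π, N, hN, hsπ⟩ := h
  refine ⟨e.hom ≫ s, π ≫ e.inv, N, hN, ?_⟩
  rw [Category.assoc, ← Category.assoc s, hsπ, Preadditive.nsmul_comp, Category.id_comp,
    Preadditive.comp_nsmul, e.hom_inv_id]

/-- Transport along an isomorphism of the dominating variety. [cite: MumfordAV1970, §19 (remark before Thm. 1, p. 169), auxiliary step] -/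
theorem of_iso_right (h : AVDominatedBy A P) (e : P ≅ Q) : AVDominatedBy A Q := by
  obtain ⟨s, π, N, hN, hsπ⟩ := h
  refine ⟨s ≫ e.hom, e.inv ≫ π, N, hN, ?_⟩
  rw [Category.assoc, e.hom_inv_id_assoc, hsπ]

/-- **Transport along an isogeny OUT OF `A`**: if `g : A → B` is an isogeny and `B` is dominated by
`P`, so is `A` (compose with `g` and a quasi-inverse `g'`, `g ≫ g' = [n]_A`: Mumford §19 Remark
p. 169, the tree's `IsIsogeny.exists_nsmul_inverse_holds`). [cite: MumfordAV1970, §19 (remark before Thm. 1, p. 169)] -/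
theorem of_isIsogeny_hom {g : A ⟶ B} (hg : AbelianVariety.IsIsogeny g) (h : AVDominatedBy B P) :
    AVDominatedBy A P := by
  obtain ⟨g', n, hn, hgg', -⟩ := AbelianVariety.IsIsogeny.exists_nsmul_inverse_holds hg
  obtain ⟨s, π, N, hN, hsπ⟩ := h
  refine ⟨g ≫ s, π ≫ g', N * n, mul_ne_zero hN hn.ne', ?_⟩
  rw [Category.assoc, ← Category.assoc s, hsπ, Preadditive.nsmul_comp, Category.id_comp,
    Preadditive.comp_nsmul, hgg', mul_smul]

/-- **Transport along an isogeny INTO `A`**: if `g : B → A` is an isogeny and `B` is dominated by `P`,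
so is `A` (`g' ≫ g = [n]_A` for a quasi-inverse `g'`). [cite: MumfordAV1970, §19 (remark before Thm. 1, p. 169)] -/
theorem of_isIsogeny_inv {g : B ⟶ A} (hg : AbelianVariety.IsIsogeny g) (h : AVDominatedBy B P) :
    AVDominatedBy A P := by
  obtain ⟨g', n, hn, -, hg'g⟩ := AbelianVariety.IsIsogeny.exists_nsmul_inverse_holds hg
  obtain ⟨s, π, N, hN, hsπ⟩ := h
  refine ⟨g' ≫ s, π ≫ g, N * n, mul_ne_zero hN hn.ne', ?_⟩
  rw [Category.assoc, ← Category.assoc s, hsπ, Preadditive.nsmul_comp, Category.id_comp,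
    Preadditive.comp_nsmul, hg'g, mul_smul]

/-- Transport along `IsIsogenous A B` (an isogeny `A → B`). [cite: MumfordAV1970, §19] -/
theorem of_isIsogenous (hAB : AbelianVariety.IsIsogenous A B) (h : AVDominatedBy B P) :
    AVDominatedBy A P := by
  obtain ⟨g, hg⟩ := hAB
  exact of_isIsogeny_hom hg h

/-- A dominating variety may be replaced by one it is dominated by — in particular by an ISOGENOUS one
(either direction), via `trans`. Recorded for the direction `P → Q`. [cite: MumfordAV1970, §19] -/
theorem trans_isIsogeny_hom (h : AVDominatedBy A P) {g : P ⟶ Q} (hg : AbelianVariety.IsIsogeny g) :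
    AVDominatedBy A Q :=
  h.trans (of_isIsogeny_hom hg (refl Q))

/-- … and for the direction `Q → P`. [cite: MumfordAV1970, §19] -/
theorem trans_isIsogeny_inv (h : AVDominatedBy A P) {g : Q ⟶ P} (hg : AbelianVariety.IsIsogeny g) :
    AVDominatedBy A Q :=
  h.trans (of_isIsogeny_inv hg (refl Q))

/-! ### Products -/

/-- `prodMap` is compatible with scalar multiples on both factors: `(n•f) × (n•g) = n • (f × g)`.
 [cite: MumfordAV1970, §19 (remark before Thm. 1, p. 169), auxiliary step] -/
theorem prodMap_nsmul {A₁ A₂ B₁ B₂ : AbelianVariety ℂ} (n : ℕ) (f : A₁ ⟶ B₁) (g : A₂ ⟶ B₂) :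
    AbelianVariety.prodMap (n • f) (n • g) = n • AbelianVariety.prodMap f g := by
  apply AbelianVariety.prod_hom_ext
  · rw [AbelianVariety.prodMap_fst, Preadditive.nsmul_comp, AbelianVariety.prodMap_fst,
      Preadditive.comp_nsmul]
  · rw [AbelianVariety.prodMap_snd, Preadditive.nsmul_comp, AbelianVariety.prodMap_snd,
      Preadditive.comp_nsmul]

/-- `prodMap` is functorial: `(f × g) ≫ (f' × g') = (f ≫ f') × (g ≫ g')`. [cite: MumfordAV1970, §19 (remark before Thm. 1, p. 169), auxiliary step] -/
theorem prodMap_comp {A₁ A₂ B₁ B₂ C₁ C₂ : AbelianVariety ℂ} (f : A₁ ⟶ B₁) (g : A₂ ⟶ B₂)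
    (f' : B₁ ⟶ C₁) (g' : B₂ ⟶ C₂) :
    AbelianVariety.prodMap f g ≫ AbelianVariety.prodMap f' g' =
      AbelianVariety.prodMap (f ≫ f') (g ≫ g') := by
  apply AbelianVariety.prod_hom_ext
  · rw [Category.assoc, AbelianVariety.prodMap_fst, AbelianVariety.prodMap_fst_assoc,
      AbelianVariety.prodMap_fst]
  · rw [Category.assoc, AbelianVariety.prodMap_snd, AbelianVariety.prodMap_snd_assoc,
      AbelianVariety.prodMap_snd]

/-- `𝟙 × 𝟙 = 𝟙`. [cite: MumfordAV1970, §19 (remark before Thm. 1, p. 169), auxiliary step] -/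
theorem prodMap_id_id (A₁ A₂ : AbelianVariety ℂ) :
    AbelianVariety.prodMap (𝟙 A₁) (𝟙 A₂) = 𝟙 (A₁.prod A₂) := by
  apply AbelianVariety.prod_hom_ext
  · rw [AbelianVariety.prodMap_fst, Category.id_comp, Category.comp_id]
  · rw [AbelianVariety.prodMap_snd, Category.id_comp, Category.comp_id]

/-- **Products**: if `A` is `N`-dominated by `P` and `A'` is `N'`-dominated by `P'`, then `A × A'` is
`NN'`-dominated by `P × P'` (rescale the two sections to the common multiplier `NN'`).
[cite: MumfordAV1970, §19] -/
theorem prod (h : AVDominatedBy A P) (h' : AVDominatedBy A' P') :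
    AVDominatedBy (A.prod A') (P.prod P') := by
  obtain ⟨s, π, N, hN, hsπ⟩ := h
  obtain ⟨s', π', N', hN', hsπ'⟩ := h'
  refine ⟨AbelianVariety.prodMap (N' • s) (N • s'), AbelianVariety.prodMap π π', N * N',
    mul_ne_zero hN hN', ?_⟩
  rw [prodMap_comp, Preadditive.nsmul_comp, Preadditive.nsmul_comp, hsπ, hsπ', ← mul_smul,
    ← mul_smul, mul_comm N' N, prodMap_nsmul, prodMap_id_id]

end AVDominatedBy

/-! ### Calculus at the scheme level -/

namespace IsDominatedBy

variable {X X' P P' : SchemeOver ℂ}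

/-- Transport along an isomorphism of the dominated scheme: if `X ≅ X'` and `X` is dominated by `P`, so
is `X'`. [cite: MumfordAV1970, §19 (remark before Thm. 1, p. 169), auxiliary step] -/
theorem of_iso (e : X' ≅ X) (h : IsDominatedBy X P) : IsDominatedBy X' P := by
  obtain ⟨s, π, N, hN, hsπ⟩ := h
  refine ⟨e.hom ≫ s, π ≫ e.inv, N, hN, fun k ↦ ?_⟩
  have hcomp : (e.hom ≫ s) ≫ π ≫ e.inv = e.hom ≫ (s ≫ π) ≫ e.inv := by simp only [Category.assoc]
  rw [hcomp, BettiUniverse.pull_comp, BettiUniverse.pull_comp, hsπ k, LinearMap.smul_comp,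
    LinearMap.id_comp, LinearMap.comp_smul, ← BettiUniverse.pull_comp, e.hom_inv_id,
    BettiUniverse.pull_id]

/-- Transport along an isomorphism of the dominating scheme. [cite: MumfordAV1970, §19 (remark before Thm. 1, p. 169), auxiliary step] -/
theorem of_iso_right (h : IsDominatedBy X P) (e : P ≅ P') : IsDominatedBy X P' := by
  obtain ⟨s, π, N, hN, hsπ⟩ := h
  refine ⟨s ≫ e.hom, e.inv ≫ π, N, hN, fun k ↦ ?_⟩
  have hcomp : (s ≫ e.hom) ≫ e.inv ≫ π = s ≫ π := by simp
  rw [hcomp, hsπ k]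

end IsDominatedBy

/-- **AV-domination up to an isomorphism of underlying varieties** (the shape the iso-complete
universe needs: its CM predicate is `∃ A, IsOfCMType A ∧ Nonempty (A.X ≅ scheme v)`). [cite: MumfordAV1970, §19 (remark before Thm. 1, p. 169), auxiliary step] -/
theorem isDominatedBy_of_iso_of_avDominatedBy {X : SchemeOver ℂ} {A P : AbelianVariety ℂ}
    (e : A.X ≅ X) (h : AVDominatedBy A P) : IsDominatedBy X P.X :=
  IsDominatedBy.of_iso e.symm h.isDominatedBy

/-! ### The leaf of M14: a realisation of `(K; Φ)` is dominated by any realisation of an INDUCED type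
`(M; Φ^M)` — Shimura 1998 §6.2 Thm. 3 (the binder `Shimura1998_Thm3_isogenousPower`) with §6.1 Cor. of
Thm. 2 (the record `Shimura1998_Thm2_Cor`); the junctions `isogeny_bettiMap_bijective`,
`product_bettiMap_bijective` are the tree's KERNEL theorems (`…_holds`), used only to see that the power
`B^h` of Theorem 3 has `h ≥ 1`. -/

section Inflation

open _root_.CategoryTheory.Limits NumberField
open Literature.AlgebraicGeometry.ComplexMultiplication
open Literature.NumberTheory.ComplexMultiplication (inducedCMType)

/-- **Inflation dominates.** If `(A, ι, θ)` realises the CM type `(K; Φ)` and `(A′, ι′, θ′)` realises the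
induced type `(M; Φ^M)` along `k : K → M`, then `A` is dominated by `A′`: by Theorem 3, `A′` is isogenous
(`g`) to a power `P = B^h` (`h ≥ 1`) of a realisation `B` of `(K; Φ)`, by the Corollary `A` is isogenous
(`u`) to `B`, and `B` is a direct factor of `P`; compose `u`, a factor inclusion, a quasi-inverse of `g`.
[cite: Shimura1998, §6.2 Theorem 3 and §6.1 Corollary of Theorem 2 (pp. 41–43)] -/
theorem avDominatedBy_of_inducedCMType (hd : Shimura1998_Thm3_isogenousPower)
    (hcor : Shimura1998_Thm2_Cor)
    {K M : Type} [Field K] [NumberField K] [IsCMField K] [Field M] [NumberField M] [IsCMField M]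
    (k : K →+* M) (Φ : CMType K)
    {A : AbelianVariety ℂ} {ι : 𝓞 K →+* End A} {θ : K →+* Module.End ℂ (complexBetti A.X 1)}
    (hA : IsCMTypeRealisation Φ A ι θ)
    {A' : AbelianVariety ℂ} {ι' : 𝓞 M →+* End A'} {θ' : M →+* Module.End ℂ (complexBetti A'.X 1)}
    (hA' : IsCMTypeRealisation (inducedCMType k Φ) A' ι' θ') :
    AVDominatedBy A A' := by
  classical
  obtain ⟨B, ιB, θB, hB, h, P, π, ⟨hlim⟩, g, hg, -⟩ := hd K M k Φ A' ι' θ' hA'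
  obtain ⟨u, hu, -⟩ := hcor K Φ A ι θ B ιB θB hA hB
  -- `h ≥ 1`: otherwise `H¹(P; ℚ) = 0`, hence `H¹(A′; ℚ) = 0` along the isogeny `g`, but `dim H¹(A′) = [M:ℚ] > 0`.
  have hh : h ≠ 0 := by
    rintro rfl
    have hP := product_bettiMap_bijective_holds 0 P B π ⟨hlim⟩
    have hgB := isogeny_bettiMap_bijective_holds A' P g hg
    haveI : Subsingleton (bettiCohomology P.X 1) := hP.2.subsingleton
    haveI : Subsingleton (bettiCohomology A'.X 1) := hgB.2.subsingleton
    have h0 : Module.finrank ℚ (bettiCohomology A'.X 1) = 0 := Module.finrank_zero_of_subsingleton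
    rw [BettiUniverse.finrank_bettiCohomology_eq hA'.1 1, hA'.2.1] at h0
    exact (Module.finrank_pos (R := ℚ) (M := M)).ne' h0
  obtain ⟨j₀⟩ : Nonempty (Fin h) := Fin.pos_iff_nonempty.mp (Nat.pos_of_ne_zero hh)
  -- `B` is a direct factor of `P = B^h`: the `j₀`-th inclusion, split by the `j₀`-th projection
  let q : (j : Fin h) → (B ⟶ B) := fun j => if j = j₀ then 𝟙 B else 0
  let incl : B ⟶ P := hlim.lift (Fan.mk B q)
  have hincl : incl ≫ π j₀ = 𝟙 B := by
    have hfac := hlim.fac (Fan.mk B q) ⟨j₀⟩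
    simp only [Fan.mk_π_app] at hfac
    refine hfac.trans ?_
    simp [q]
  have hBP : AVDominatedBy B P := ⟨incl, π j₀, 1, one_ne_zero, by rw [hincl, one_smul]⟩
  exact (AVDominatedBy.of_isIsogeny_hom hu hBP).trans_isIsogeny_inv hg

end Inflation

end Literature.AlgebraicGeometry.ComplexMultiplication.Domination

end
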